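import Literature.Topology.FourManifolds.GradientLike
import Literature.Topology.FourManifolds.Morse
import Literature.Topology.FourManifolds.MorseProofs
import Mathlib.Geometry.Manifold.PartitionOfUnity
import Mathlib.Geometry.Manifold.Algebra.LieGroup
import Mathlib.Topology.MetricSpace.HausdorffDistance
import HarnessLib

/-!
# A vector field of unit speed across a slab without critical values

Topic `Literature/Topology/FourManifolds` (trunk FourManL, notion `kirby_calculus_handles`);
first ingredient of the *regular interval theorem* (rung F1 of the plan recorded under the
fact item `provefact-Literature.SPC4.exists_isMorse_isSelfIndexing`, see `MorseSingleMinimum.lean`,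
`Flows.lean`).  Everything in this file is **proved**.

Milnor, *Morse theory* (1963), Thm. 3.1, and Matsumoto, *An introduction to Morse theory*
(2001), Thm. 2.31 (p. 74: *if `f` has no critical value in `[a, b]` then `M_{[a,b]}` is
diffeomorphic to `f⁻¹(a) × [0, 1]`*) and Thm. 3.1 (p. 79: *`M_a ≅ M_b`*): the proofs push level
sets along the integral curves of a smooth vector field `Y` on `M` with `Y·f ≡ 1` near the
compact set `f⁻¹[a, b]` (Matsumoto, p. 75: "let `X` be a gradient-like vector field for `f` on
`U` and set `Y = 1/(X·f) X`"; Milnor 1963: `X = ρ · grad f` with `ρ = 1/⟨grad f, grad f⟩`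
throughout `f⁻¹[a, b]`).  Milnor, *Lectures on the h-cobordism theorem* (1965), proof of
Thm. 3.4, normalises a gradient-like field the same way.  Without
a Riemannian metric, we build such a field by a partition of unity, extending the tree's
`Literature.Topology.FourManifolds.exists_contMDiffSection_forall_mlineDeriv_eq_one` (`GradientLike.lean`, the case without
any critical point) to functions with critical points away from the slab:

* `Literature.Topology.FourManifolds.exists_contMDiffOn_section_mlineDeriv_eq_one` — near a regular point there is a smooth
  local vector field `s` with `s(f) = 1`;
* `Literature.Topology.FourManifolds.exists_contMDiffSection_mlineDeriv_eq_one_on` — for a closed set `C` of regular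
  points there is a smooth global vector field `ξ` with `ξ(f) = 1` on `C`;
* `Literature.Topology.FourManifolds.exists_contMDiffSection_mlineDeriv_eq_one_slab` — on a compact manifold, if `[a, b]`
  contains no critical value of `f`, there are `δ > 0` and a smooth vector field `ξ` with
  `ξ(f) = 1` on `f⁻¹[a - δ, b + δ]`.

## References

* J. Milnor, *Morse theory*, Ann. of Math. Studies 51 (1963), §3, proof of Thm. 3.1.
  [Milnor1963]
* Y. Matsumoto, *An introduction to Morse theory*, Transl. Math. Monogr. 208 (2001),
  Thm. 2.31 (p. 74–75), Thm. 3.1 (p. 79). [Matsumoto2001]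
* J. Milnor, *Lectures on the h-cobordism theorem* (1965), Lemma 3.2 and proof of Thm. 3.4.
  [MilnorHCobordism1965]
-/

open scoped Manifold ContDiff Topology
open Set Function Bundle Filter

noncomputable section

namespace Literature.Topology.FourManifolds

variable {E : Type*} [NormedAddCommGroup E] [NormedSpace ℝ E]
  {H : Type*} [TopologicalSpace H] {I : ModelWithCorners ℝ E H}
  {M : Type*} [TopologicalSpace M] [ChartedSpace H M]

/-- The affine hyperplane `{v ∈ T_x M | v(f) = 1}` is convex. [folklore] -/
theorem convex_setOf_mlineDeriv_eq_one (f : M → ℝ) (x : M) :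
    Convex ℝ {v : TangentSpace I x | mlineDeriv I f x v = 1} := by
  intro v hv w hw a b _ _ hab
  simp only [mem_setOf_eq, mlineDeriv_add, mlineDeriv_smul] at hv hw ⊢
  rw [hv, hw, mul_one, mul_one, hab]

/-- A family of convex "constraint sets": the hyperplane `{v | v(f) = 1}` over the points of
`C`, the whole tangent space elsewhere. [folklore] -/
theorem convex_setOf_imp_mlineDeriv_eq_one (f : M → ℝ) (C : Set M) (x : M) :
    Convex ℝ {v : TangentSpace I x | x ∈ C → mlineDeriv I f x v = 1} := by
  by_cases hx : x ∈ C
  · simpa only [hx, forall_true_left] using convex_setOf_mlineDeriv_eq_one (I := I) f x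
  · simp only [hx, IsEmpty.forall_iff, setOf_true]
    exact convex_univ

variable [IsManifold I ∞ M]

/-- **A local vector field of unit speed near a regular point** (Milnor 1965, proof of
Lemma 3.2 and of Thm. 3.4: a local field with `ξ(f) > 0`, divided by `ξ(f)`).  If
`df_{x₀} ≠ 0` there are a neighbourhood `u` of `x₀` and a vector field `s`, smooth on `u`,
with `s(f) = 1` on `u`. [cite: MilnorHCobordism1965, proof of Lemma 3.2 and of Thm. 3.4] -/
theorem exists_contMDiffOn_section_mlineDeriv_eq_one {f : M → ℝ} (hf : ContMDiff I 𝓘(ℝ, ℝ) ∞ f)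
    {x₀ : M} (h : mfderiv I 𝓘(ℝ, ℝ) f x₀ ≠ 0) :
    ∃ u ∈ 𝓝 x₀, ∃ s : Π x : M, TangentSpace I x,
      ContMDiffOn I I.tangent ∞ (fun x => (⟨x, s x⟩ : TangentBundle I M)) u ∧
      ∀ y ∈ u, mlineDeriv I f y (s y) = 1 := by
  obtain ⟨v₀, hv₀⟩ := exists_mlineDeriv_ne_zero h
  set v₁ : TangentSpace I x₀ := (mlineDeriv I f x₀ v₀)⁻¹ • v₀ with hv₁
  have hv₁' : mlineDeriv I f x₀ v₁ = 1 := by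
    rw [hv₁, mlineDeriv_smul, inv_mul_cancel₀ hv₀]
  obtain ⟨u, s, hu, hx₀u, hsx₀, hs⟩ := exists_contMDiffOn_section_eq (I := I) x₀ v₁
  -- `s(f) > 0` near `x₀`
  set g : M → ℝ := fun x => mlineDeriv I f x (s x) with hg
  have hgs : ContMDiffOn I 𝓘(ℝ, ℝ) ∞ g u := contMDiffOn_mlineDeriv_section hf hs
  have hcont : ContinuousAt g x₀ :=
    (hgs.continuousOn.continuousWithinAt hx₀u).continuousAt (hu.mem_nhds hx₀u)
  have hpos : ∀ᶠ x in 𝓝 x₀, 0 < g x := by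
    apply hcont.eventually (p := fun r : ℝ => 0 < r)
    change ∀ᶠ r in 𝓝 (mlineDeriv I f x₀ (s x₀)), 0 < r
    rw [hsx₀, hv₁']
    exact Ioi_mem_nhds one_pos
  set u' : Set M := u ∩ {x | 0 < g x} with hu'
  have hu'n : u' ∈ 𝓝 x₀ := Filter.inter_mem (hu.mem_nhds hx₀u) hpos
  -- normalise on `u'`
  have hginv : ContMDiffOn I 𝓘(ℝ, ℝ) ∞ (fun x => (g x)⁻¹) u' :=
    (hgs.mono inter_subset_left).inv₀ fun x hx => hx.2.ne'
  refine ⟨u', hu'n, fun x => (g x)⁻¹ • s x, ?_, fun y hy => ?_⟩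
  · exact hginv.smul_section (hs.mono inter_subset_left)
  · change mlineDeriv I f y ((g y)⁻¹ • s y) = 1
    rw [mlineDeriv_smul]
    exact inv_mul_cancel₀ hy.2.ne'

variable [FiniteDimensional ℝ E] [T2Space M] [SigmaCompactSpace M]

/-- **A smooth vector field of unit speed along a closed set of regular points** (partition of
unity, as in Milnor 1965, proof of Lemma 3.2).  If `C ⊆ M` is closed and `df_x ≠ 0` for every
`x ∈ C`, there is a smooth vector field `ξ` on `M` with `ξ(f) = 1` on `C` (Mathlib's
`exists_contMDiffSection_forall_mem_convex_of_local` for the convex sets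
`{v | x ∈ C → v(f) = 1}`, fed with the local unit fields near points of `C` and with the zero
field on the open set `Cᶜ`). [cite: MilnorHCobordism1965, proof of Lemma 3.2 (partition of unity)] -/
theorem exists_contMDiffSection_mlineDeriv_eq_one_on {f : M → ℝ} (hf : ContMDiff I 𝓘(ℝ, ℝ) ∞ f)
    {C : Set M} (hC : IsClosed C) (hreg : ∀ x ∈ C, mfderiv I 𝓘(ℝ, ℝ) f x ≠ 0) :
    ∃ ξ : Cₛ^∞⟮I; E, (TangentSpace I : M → Type _)⟯, ∀ x ∈ C, mlineDeriv I f x (ξ x) = 1 := by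
  obtain ⟨ξ, hξ⟩ : ∃ ξ : Cₛ^∞⟮I; E, (TangentSpace I : M → Type _)⟯,
      ∀ x, ξ x ∈ {v : TangentSpace I x | x ∈ C → mlineDeriv I f x v = 1} := by
    refine exists_contMDiffSection_forall_mem_convex_of_local I (TangentSpace I : M → Type _)
      (fun x => {v : TangentSpace I x | x ∈ C → mlineDeriv I f x v = 1})
      (fun x => convex_setOf_imp_mlineDeriv_eq_one f C x) (fun x₀ => ?_)
    by_cases hx₀ : x₀ ∈ C
    · obtain ⟨u, hu, s, hs, hs1⟩ := exists_contMDiffOn_section_mlineDeriv_eq_one hf (hreg x₀ hx₀)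
      exact ⟨u, hu, s, hs, fun y hy _ => hs1 y hy⟩
    · refine ⟨Cᶜ, hC.isOpen_compl.mem_nhds hx₀, fun _ => 0, ?_, fun y hy hyC => absurd hyC hy⟩
      exact (contMDiff_zeroSection ℝ (TangentSpace I : M → Type _)).contMDiffOn
  exact ⟨ξ, fun x hx => hξ x hx⟩

omit [FiniteDimensional ℝ E] [T2Space M] [SigmaCompactSpace M] in
/-- On a compact manifold, if `[a, b]` contains no critical value of the smooth function `f`,
then neither does `[a - δ, b + δ]` for some `δ > 0` (the critical values form a compact
set). [folklore] -/
theorem exists_pos_forall_mem_Icc_mfderiv_ne_zero [CompactSpace M] {f : M → ℝ}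
    (hf : ContMDiff I 𝓘(ℝ, ℝ) ∞ f) {a b : ℝ}
    (hreg : ∀ x, f x ∈ Icc a b → mfderiv I 𝓘(ℝ, ℝ) f x ≠ 0) :
    ∃ δ : ℝ, 0 < δ ∧ ∀ x, f x ∈ Icc (a - δ) (b + δ) → mfderiv I 𝓘(ℝ, ℝ) f x ≠ 0 := by
  rcases lt_or_ge b a with hba | hab
  · -- empty slab: make the enlarged slab empty as well
    refine ⟨(a - b) / 3, by linarith, fun x hx => ?_⟩
    exact absurd (hx.1.trans hx.2) (by linarith)
  -- the compact set of critical values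
  set K : Set ℝ := f '' criticalSet I f with hK
  have hKc : IsCompact K :=
    ((isClosed_criticalSet_of_contMDiff hf (by norm_cast)).isCompact).image hf.continuous
  rcases K.eq_empty_or_nonempty with hKe | hKne
  · refine ⟨1, one_pos, fun x _ hx => ?_⟩
    have : f x ∈ K := ⟨x, hx, rfl⟩
    rw [hKe] at this
    exact this
  -- the distance from the critical values to `[a, b]` is positive
  obtain ⟨y₀, hy₀K, hy₀⟩ := hKc.exists_isMinOn hKne (Metric.continuous_infDist_pt (s := Icc a b)).continuousOn
  have hne : (Icc a b).Nonempty := nonempty_Icc.2 hab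
  have hpos : 0 < Metric.infDist y₀ (Icc a b) := by
    rw [← Metric.infDist_pos_iff_notMem_closure hne, closure_Icc]
    rintro hy₀ab
    obtain ⟨x, hx, rfl⟩ := hy₀K
    exact hreg x hy₀ab hx
  set δ : ℝ := Metric.infDist y₀ (Icc a b) / 2 with hδ
  refine ⟨δ, by positivity, fun x hx hcrit => ?_⟩
  -- a point of the enlarged slab is within `δ` of `[a, b]`, a critical value is not
  have hfar : Metric.infDist y₀ (Icc a b) ≤ Metric.infDist (f x) (Icc a b) :=
    hy₀ (a := f x) ⟨x, hcrit, rfl⟩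
  have hmem : max a (min (f x) b) ∈ Icc a b :=
    ⟨le_max_left _ _, max_le hab (min_le_right _ _)⟩
  have hdist : dist (f x) (max a (min (f x) b)) ≤ δ := by
    rcases le_total (f x) a with h1 | h1
    · rw [min_eq_left (h1.trans hab), max_eq_left h1, Real.dist_eq, abs_of_nonpos (by linarith)]
      linarith [hx.1]
    · rcases le_total (f x) b with h2 | h2
      · rw [min_eq_left h2, max_eq_right h1, dist_self]
        positivity
      · rw [min_eq_right h2, max_eq_right hab, Real.dist_eq, abs_of_nonneg (by linarith)]
        linarith [hx.2]
  have hnear : Metric.infDist (f x) (Icc a b) ≤ δ :=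
    (Metric.infDist_le_dist_of_mem hmem).trans hdist
  linarith

/-- **A smooth vector field of unit speed across a slab without critical values** (Milnor
1963, proof of Thm. 3.1: "`X = ρ · grad f`, `⟨X, grad f⟩ = 1` throughout `f⁻¹[a, b]`";
Milnor 1965, proof of Thm. 3.4).  On a compact manifold (any model with corners), if
`[a, b]` contains no critical value of the smooth function `f`, there are `δ > 0` and a smooth
vector field `ξ` on `M` with `ξ(f) = 1` at every point of `f⁻¹[a - δ, b + δ]` (Matsumoto 2001, proof of
Thm. 2.31, p. 75: the field `Y = 1/(X·f) X` on `U = f⁻¹(-ε, ε)`). [cite: Matsumoto2001, proof of Thm. 2.31 (p. 75)] [cite: Milnor1963, proof of Thm. 3.1] -/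
theorem exists_contMDiffSection_mlineDeriv_eq_one_slab [CompactSpace M] {f : M → ℝ}
    (hf : ContMDiff I 𝓘(ℝ, ℝ) ∞ f) {a b : ℝ}
    (hreg : ∀ x, f x ∈ Icc a b → mfderiv I 𝓘(ℝ, ℝ) f x ≠ 0) :
    ∃ (ξ : Cₛ^∞⟮I; E, (TangentSpace I : M → Type _)⟯) (δ : ℝ), 0 < δ ∧
      ∀ x, f x ∈ Icc (a - δ) (b + δ) → mlineDeriv I f x (ξ x) = 1 := by
  obtain ⟨δ, hδ, hreg'⟩ := exists_pos_forall_mem_Icc_mfderiv_ne_zero hf hreg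
  have hC : IsClosed (f ⁻¹' Icc (a - δ) (b + δ)) := isClosed_Icc.preimage hf.continuous
  obtain ⟨ξ, hξ⟩ := exists_contMDiffSection_mlineDeriv_eq_one_on hf hC fun x hx => hreg' x hx
  exact ⟨ξ, δ, hδ, fun x hx => hξ x hx⟩

end Literature.Topology.FourManifolds
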